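import Literature.Geometry.Lorentzian.FinalEraPackage2
import Summits.FinalStateConjecture.FinalStateConjecture.Theorems.ClusterCompletenessOmegaLimitMultiKerrSettlesRecurs
import HarnessLib

/-!
# Stub H_rad `stub_honestRadii` — quantitative effacement and honest growing radii
# (crux `DispersingCapture`, stmt-FinalStateConjecture-17643, line `registered`, skeleton r10; lead prover c6, 2026-08-17)

Route `DissipativeFinalMotions` of the summit `FinalStateConjecture`. From the rev-2 final-era package
`IsFinalEra₂` (clause (H3), effacement: an eventually isolated hole converges in `C²` on every truncated slab
`{rᵢ ≤ R}`) and pairwise dispersal of the labels (which supplies the isolation premise of (H3) for every hole,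
radius and tolerance): (i) at every fixed radius `L` and tolerance `ε > 0` the truncated `C²` deviation of hole
chart `i` is eventually `≤ ε`; (ii) by the diagonal lemma `exists_diagonal_radius`
(`Theorems/ClusterCompletenessOmegaLimitMultiKerrSettlesRecurs.lean`) there are radii `Rᵢ → ∞` with
`Rᵢ(τ) ≥ max(r₊(Mᵢ,aᵢ),0)+1` and `Rᵢ(τ) ≥ 2ρ₀` for all `τ`, along which `truncDeviationCk (B i) (Ψ i) 2 (Rᵢ τ) τ → 0`.

References: Dafermos–Holzegel–Rodnianski–Taylor arXiv:2104.08222, §1 (near zones); Dafermos–Luk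
arXiv:1710.01722, Conjecture 1.
-/

set_option linter.dupNamespace false

noncomputable section

open scoped Manifold ContDiff Topology
open Filter Set Function MeasureTheory Literature.Geometry.Lorentzian

namespace Summit.FinalStateConjecture.FinalStateConjecture.Theorems.DissipativeFinalMotions.DispersingCapture

/-- **H_rad — quantitative effacement and honest growing radii.** From (H3) of `IsFinalEra₂` and pairwise
dispersal: (i) for every hole `i`, radius `L` and `ε > 0`, eventually `truncDeviationCk (B i) (Ψ i) 2 L τ ≤ ε`;
(ii) radii `Rᵢ → ∞`, `Rᵢ ≥ max(r₊,0)+1`, `Rᵢ ≥ 2ρ₀`, with `truncDeviationCk (B i) (Ψ i) 2 (Rᵢ τ) τ → 0`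
(diagonal lemma). DHRT arXiv:2104.08222, §1. -/
theorem stub_honestRadii : open scoped Manifold Topology in ∀ (X : Type) [TopologicalSpace X] [ChartedSpace (EuclideanSpace ℝ (Fin 3)) X] [IsManifold (𝓡 3) ((⊤ : ℕ∞) : WithTop ℕ∞) X] [T2Space X] [SecondCountableTopology X] [ConnectedSpace X], ∀ (D : Literature.Geometry.Lorentzian.InitialDataSet (𝓡 3) X) (𝒟 : Literature.Geometry.Lorentzian.VacuumCauchyDevelopment D) (N : ℕ) (M a : Fin N → ℝ) (T δ V C₁ C₂ ρ₀ κ : ℝ) (ξ : Fin N → ℝ → EuclideanSpace ℝ (Fin 3)) (β : ℝ → ℝ) (U₀ : TopologicalSpace.Opens Literature.Geometry.Lorentzian.E4) (B₀ : Literature.Geometry.Lorentzian.ModelBackground) (B : Fin N → Literature.Geometry.Lorentzian.ModelBackground) (Ψ₀ : B₀.domain → 𝒟.carrier) (Ψ : (i : Fin N) → (B i).domain → 𝒟.carrier) (O : Set 𝒟.carrier), 𝒟.toCauchyDevelopment.IsFinalEra₂ N M a T δ V C₁ C₂ ρ₀ κ ξ β U₀ B₀ B Ψ₀ Ψ O →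 (∀ i j, i ≠ j → Filter.Tendsto (fun t ↦ ‖ξ i t - ξ j t‖) Filter.atTop Filter.atTop) →
    (∀ i (L ε : ℝ), 0 < ε → ∃ T'' : ℝ, ∀ τ, T'' ≤ τ → 𝒟.toSpacetime.truncDeviationCk (B i) (Ψ i) 2 L τ ≤ ENNReal.ofReal ε) ∧
    ∃ R : Fin N → ℝ → ℝ, (∀ i, Filter.Tendsto (R i) Filter.atTop Filter.atTop ∧ ∀ τ, max (Literature.Geometry.Lorentzian.Kerr.rPlus (M i) (a i)) 0 + 1 ≤ R i τ) ∧ (∀ i τ, 2 * ρ₀ ≤ R i τ) ∧ (∀ i, Filter.Tendsto (fun τ ↦ 𝒟.toSpacetime.truncDeviationCk (B i) (Ψ i) 2 (R i τ) τ) Filter.atTop (nhds 0)) := by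
  intro X _ _ _ _ _ _ D 𝒟 N M a T δ V C₁ C₂ ρ₀ κ ξ β U₀ B₀ B Ψ₀ Ψ O hera hdisp
  obtain ⟨-, -, -, -, -, -, -, -, -, -, -, -, -, -, -, -, -, -, -, -, -, -, h₂₃, -⟩ := hera
  -- Part (i): effacement (H3) at every fixed radius, its isolation premise supplied by dispersal.
  have hfix : ∀ i (L ε : ℝ), 0 < ε → ∃ T'' : ℝ, ∀ τ, T'' ≤ τ →
      𝒟.toSpacetime.truncDeviationCk (B i) (Ψ i) 2 L τ ≤ ENNReal.ofReal ε := by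
    intro i L ε hε
    obtain ⟨D', hD'⟩ := h₂₃ i L ε hε
    have hev : ∀ᶠ t in atTop, ∀ j, j ≠ i → D' ≤ ‖ξ i t - ξ j t‖ := by
      refine Filter.eventually_all.2 fun j ↦ ?_
      by_cases hji : j = i
      · exact Filter.Eventually.of_forall fun t h ↦ absurd hji h
      · exact ((hdisp i j (Ne.symm hji)).eventually (eventually_ge_atTop D')).mono
          fun t ht _ ↦ ht
    obtain ⟨T', hT'⟩ := Filter.eventually_atTop.1 hev
    exact hD' T' hT'
  refine ⟨hfix, ?_⟩
  -- Part (ii): fixed-radius convergence to `0`, then diagonal radii above the floor `L₀ i`.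
  have htend : ∀ i (L : ℝ),
      Tendsto (fun τ ↦ 𝒟.toSpacetime.truncDeviationCk (B i) (Ψ i) 2 L τ) atTop (𝓝 0) := by
    intro i L
    rw [ENNReal.tendsto_nhds_zero]
    intro ε hε
    obtain ⟨r, -, hr0, hrε⟩ := ENNReal.lt_iff_exists_real_btwn.1 hε
    obtain ⟨T'', hT''⟩ := hfix i L r (ENNReal.ofReal_pos.1 hr0)
    exact Filter.eventually_atTop.2 ⟨T'', fun τ hτ ↦ (hT'' τ hτ).trans hrε.le⟩
  set L₀ : Fin N → ℝ := fun i ↦ max (max (Kerr.rPlus (M i) (a i)) 0 + 1) (2 * ρ₀)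
  have hdiag : ∀ i, ∃ S : ℝ → ℝ, Tendsto S atTop atTop ∧
      Tendsto (fun τ ↦ 𝒟.toSpacetime.truncDeviationCk (B i) (Ψ i) 2 (max (S τ) (L₀ i)) τ)
        atTop (𝓝 0) := fun i ↦
    Summit.FinalStateConjecture.FinalStateConjecture.Theorems.ClusterCompleteness.exists_diagonal_radius
      (f := fun L τ ↦ 𝒟.toSpacetime.truncDeviationCk (B i) (Ψ i) 2 (max L (L₀ i)) τ)
      fun L ↦ htend i (max L (L₀ i))
  choose S hS hS' using hdiag
  refine ⟨fun i τ ↦ max (S i τ) (L₀ i), fun i ↦ ⟨?_, fun τ ↦ ?_⟩, fun i τ ↦ ?_, hS'⟩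
  · exact Filter.tendsto_atTop_mono (fun τ ↦ le_max_left _ _) (hS i)
  · exact (le_max_left _ _).trans (le_max_right _ _)
  · exact (le_max_right _ _).trans (le_max_right _ _)

end Summit.FinalStateConjecture.FinalStateConjecture.Theorems.DissipativeFinalMotions.DispersingCapture

end
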